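import Summits.AnomalousDissipation.AnomalousDissipation.Theorems.ImpulseGridGridInjectionIdentity
import Literature.Analysis.FluidPDE.TorusClassicalLerayHopfProofs
import Literature.Analysis.FluidPDE.LongTimeAveragePeriodic

/-!
# Crux `GridSigns` (stmt-AnomalousDissipation-1771) — coherent loud wakes give `GridSigns`

Helper for the crux `GridSigns` of route ImpulseGrid (line `Sketch`, coherent-wake reduction of
the card `imprint-subtraction-production-signs`): `GridSigns` follows from a vanishing-viscosity
family of time-PERIODIC classical wakes of the grid with drift `c`, energy bounded uniformly in
`j` and `t`, nonnegative period-mean resonant work `∫₀^τ (G,u) ≥ 0` and a period-mean dissipation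
excess `c·∫₀^τ (ν‖∇u‖² − (G,u)) + ν ∫₀^τ (u, Δ(Ψ•G)) ≥ τ·η` (`gridSigns_of_coherentWakes`).

Ingredients (all in the tree): classical global solutions are global Leray–Hopf
(`IsClassicalNSSolutionOn.isGlobalLerayHopf`, Robinson–Rodrigo–Sadowski 2016 Thm. 6.5); the energy
equality of classical solutions over one period (`IsClassicalNSSolutionOn.energy_eq`); Cesàro means
of periodic functions converge to the period mean (`tendsto_timeMean_atTop_of_periodic`);
generalized limits exist (`GeneralizedLimit.nonempty_holds`) and extend the limit
(`GeneralizedLimit.longTimeAvg_eq_of_tendsto`, Doering–Foias 2002 §2); and the grid injection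
identity (`impulseGrid_gridInjectionIdentity`, item stmt-AnomalousDissipation-1774), which turns the
sign condition (b) into `c·(resonant work − injection) − ν(u,Δ(Ψ•G))`, all three being period
means along a periodic wake. No new definitions.
-/

noncomputable section

-- `Summit.<Summit>.<Problem>` is the tree's mandated summit-side namespace (CONVENTIONS §2); for this
-- single-conjunct summit the two coincide, so the duplicate is deliberate.
set_option linter.dupNamespace false

open MeasureTheory Set Filter Topology
open scoped InnerProductSpace RealInnerProductSpace

namespace Summit.AnomalousDissipation.AnomalousDissipation.Theorems.ImpulseGridGridSigns

open Literature.Analysis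
open Literature.Analysis.FluidPDE
open Literature.Analysis.FunctionSpaces Literature.Analysis.FunctionSpaces.Torus
open Summit.AnomalousDissipation.AnomalousDissipation.Theses.ImpulseGrid

/-! ### Transfer: coherent loud wakes give `GridSigns` -/

section Transfer

variable {Φ Ψ : UnitAddTorus (Fin 3) → ℝ} {G : UnitAddTorus (Fin 3) → EuclideanSpace ℝ (Fin 3)}
  {ν τ : ℝ} {u : ℝ → UnitAddTorus (Fin 3) → EuclideanSpace ℝ (Fin 3)}
  {p : ℝ → UnitAddTorus (Fin 3) → ℝ}

/-- Along a `τ`-periodic trajectory every slice functional is `τ`-periodic in time. [folklore] -/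
theorem periodic_comp (hper : Function.Periodic u τ) (g : (UnitAddTorus (Fin 3) → EuclideanSpace ℝ (Fin 3)) → ℝ) :
    Function.Periodic (fun t => g (u t)) τ := fun t => by
  simp only [hper t]

/-- Generalized long-time averages of a `τ`-periodic slice functional equal its period mean
(`tendsto_timeMean_atTop_of_periodic` and `GeneralizedLimit.longTimeAvg_eq_of_tendsto`). [folklore] -/
theorem longTimeAvg_eq_periodMean (Λ : GeneralizedLimit) (hper : Function.Periodic u τ) (hτ : 0 < τ)
    (g : (UnitAddTorus (Fin 3) → EuclideanSpace ℝ (Fin 3)) → ℝ) :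
    Λ.longTimeAvg (fun t => g (u t)) = τ⁻¹ * ∫ t in (0 : ℝ)..τ, g (u t) :=
  Λ.longTimeAvg_eq_of_tendsto (tendsto_timeMean_atTop_of_periodic (periodic_comp hper g) hτ)

/-- Continuity in time of the pairing `t ↦ ∫⟪a, u t⟫` with a fixed smooth field, along a classical
solution on all of `ℝ`. [folklore] -/
theorem continuous_integral_inner_const
    (h : FunctionSpaces.Torus.IsClassicalNSSolutionOn Set.univ ν (fun _ => fun x => Φ x • G x) u p)
    {a : UnitAddTorus (Fin 3) → EuclideanSpace ℝ (Fin 3)} (ha : IsSmooth a) :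
    Continuous (fun t => ∫ x, ⟪a x, u t x⟫) := by
  have hs : IsSmoothSpaceTimeOn Set.univ (fun t x => ⟪a x, u t x⟫) :=
    (isSmoothSpaceTimeOn_const ha Set.univ).inner h.smooth_velocity
  rw [← continuousOn_univ]
  exact hs.continuousOn_integral convex_univ

/-- Continuity in time of `t ↦ ‖∇u(t)‖₂²` along a classical solution on all of `ℝ`. [folklore] -/
theorem continuous_gradNormSq
    (h : FunctionSpaces.Torus.IsClassicalNSSolutionOn Set.univ ν (fun _ => fun x => Φ x • G x) u p) :
    Continuous (fun t => gradNormSq (u t)) := by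
  rw [← continuousOn_univ]
  exact h.smooth_velocity.continuousOn_gradNormSq convex_univ uniqueDiffOn_univ

/-- **Period energy balance** of a periodic classical solution: over one period the work of the
force equals the viscous dissipation, `∫₀^τ (Φ•G, u) = ν ∫₀^τ ‖∇u‖₂²`
(`IsClassicalNSSolutionOn.energy_eq` on `[0, τ]` and `u τ = u 0`). [folklore] -/
theorem period_work_eq_dissipation
    (h : FunctionSpaces.Torus.IsClassicalNSSolutionOn Set.univ ν (fun _ => fun x => Φ x • G x) u p)
    (hper : Function.Periodic u τ) (hτ : 0 < τ) :
    ∫ t in (0 : ℝ)..τ, ∫ x, ⟪Φ x • G x, u t x⟫ = ν * ∫ t in (0 : ℝ)..τ, gradNormSq (u t) := by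
  have hE := h.energy_eq convex_univ hτ.le (subset_univ _)
  have h0 : u τ = u 0 := by simpa using hper 0
  rw [h0] at hE
  linarith

/-- **The transfer** (line `Sketch`): coherent loud periodic wakes with nonnegative resonant work
give `GridSigns`. For each `j`: `u j` is a global Leray–Hopf solution from `u j 0`
(`IsClassicalNSSolutionOn.isGlobalLerayHopf`); energies are bounded by `E/2`; every long-time
average in the statement is a period mean (periodicity); (a) is the nonnegative resonant work;
and by the grid injection identity (stmt-1774) with `∫ΦΨ|G|² = 0` and the period energy balance,
`Λ⟨∫⟪w,(w·∇)(Ψ•G)⟫⟩ = −τ⁻¹[c ∫₀^τ(ν‖∇u‖² − (G,u)) + ν∫₀^τ (u,Δ(Ψ•G))] ≤ −η`. [folklore] -/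
theorem gridSigns_of_coherentWakes
    (hC : ∃ (Φ Ψ : UnitAddTorus (Fin 3) → ℝ) (G : UnitAddTorus (Fin 3) → EuclideanSpace ℝ (Fin 3)) (c η : ℝ),
      IsSmooth Φ ∧ IsSmooth Ψ ∧ IsSmooth G ∧
      (∀ (s : UnitAddCircle) x, Ψ (x + Pi.single (1 : Fin 3) s) = Ψ x ∧ Ψ (x + Pi.single (2 : Fin 3) s) = Ψ x) ∧
      (∀ (s : UnitAddCircle) x, G (x + Pi.single (0 : Fin 3) s) = G x) ∧ (∀ x, G x 0 = 0) ∧ IsDivFree G ∧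
      (∀ x, Torus.partialDeriv 0 Ψ x = Φ x - 1) ∧ (∫ x, Φ x * Ψ x * ‖G x‖ ^ 2 = 0) ∧
      IsSmooth (fun x => Φ x • G x) ∧ IsDivFree (fun x => Φ x • G x) ∧ HasZeroMean (fun x => Φ x • G x) ∧
      0 < c ∧ 0 < η ∧
      ∃ (ν τ : ℕ → ℝ) (u : ℕ → ℝ → UnitAddTorus (Fin 3) → EuclideanSpace ℝ (Fin 3))
        (p : ℕ → ℝ → UnitAddTorus (Fin 3) → ℝ),
        (∀ j, 0 < ν j) ∧ Tendsto ν atTop (nhds 0) ∧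
        (∀ j, FunctionSpaces.Torus.IsClassicalNSSolutionOn Set.univ (ν j) (fun _ => fun x => Φ x • G x) (u j) (p j) ∧
          0 < τ j ∧ Function.Periodic (u j) (τ j)) ∧
        (∀ j, ∫ x, u j 0 x = c • EuclideanSpace.single 0 1) ∧
        (∃ E : ℝ, ∀ j t, ∫ x, ‖u j t x‖ ^ 2 ≤ E) ∧
        (∀ j, 0 ≤ ∫ t in (0 : ℝ)..τ j, ∫ x, ⟪G x, u j t x⟫) ∧
        (∀ j, τ j * η ≤ c * (∫ t in (0 : ℝ)..τ j, (ν j * gradNormSq (u j t) - ∫ x, ⟪G x, u j t x⟫))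
            + ν j * (∫ t in (0 : ℝ)..τ j, ∫ x, ⟪u j t x, Torus.laplacian (fun y => Ψ y • G y) x⟫))) :
    GridSigns := by
  obtain ⟨Φ, Ψ, G, c, η, hΦ, hΨ, hG, hΨinv, hGinv, hG0, hGdiv, hΨ', hnorm, hf1, hf2, hf3, hc, hη,
    ν, τ, u, p, hν, hν0, hsol, hmom, ⟨E, hE⟩, ha, hb⟩ := hC
  obtain ⟨Λ⟩ := (GeneralizedLimit.nonempty_holds : Nonempty GeneralizedLimit)
  -- per-`j` facts
  have hLH : ∀ j, FluidPDE.Torus.IsGlobalLerayHopf (ν j) (fun _ => fun x => Φ x • G x) (u j 0) (u j) :=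
    fun j => (hsol j).1.isGlobalLerayHopf
  have hsup : ∀ j, ∃ C : ℝ, ∀ t : ℝ, 0 ≤ t → kineticEnergy (u j t) ≤ C := fun j =>
    ⟨2⁻¹ * E, fun t _ => by
      unfold kineticEnergy
      exact mul_le_mul_of_nonneg_left (hE j t) (by norm_num)⟩
  refine ⟨Φ, Ψ, G, c, η, Λ, hΦ, hΨ, hG, hΨinv, hGinv, hG0, hGdiv, hΨ', hnorm, hf1, hf2, hf3, hc, hη,
    ν, fun j => u j 0, u, hν, hν0, hLH, hmom, ⟨E, fun j => ?_⟩, fun j => ?_, fun j => ?_⟩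
  · -- mean energy: the running means of the periodic `t ↦ ∫‖u j t‖²` converge to the period mean
    obtain ⟨hcl, hτ, hper⟩ := hsol j
    rw [meanEnergy_eq_longTimeAvgSup,
      longTimeAvgSup_eq_of_periodic (periodic_comp hper fun v => ∫ x, ‖v x‖ ^ 2) hτ]
    have hEnn : 0 ≤ E := le_trans (integral_nonneg fun x => sq_nonneg _) (hE j 0)
    have hbound : ‖∫ t in (0 : ℝ)..τ j, ∫ x, ‖u j t x‖ ^ 2‖ ≤ E * |τ j - 0| := by
      refine intervalIntegral.norm_integral_le_of_norm_le_const fun t _ => ?_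
      rw [Real.norm_of_nonneg (integral_nonneg fun x => sq_nonneg _)]
      exact hE j t
    rw [sub_zero, abs_of_pos hτ] at hbound
    calc (τ j)⁻¹ * ∫ t in (0 : ℝ)..τ j, ∫ x, ‖u j t x‖ ^ 2
        ≤ (τ j)⁻¹ * (E * τ j) :=
          mul_le_mul_of_nonneg_left ((le_abs_self _).trans hbound) (inv_nonneg.2 hτ.le)
      _ = E := by field_simp
  · -- (a) no reversal: the period-mean resonant work is nonnegative
    obtain ⟨hcl, hτ, hper⟩ := hsol j
    rw [longTimeAvg_eq_periodMean Λ hper hτ fun v => ∫ x, ⟪G x, v x⟫]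
    exact mul_nonneg (inv_nonneg.2 hτ.le) (ha j)
  · -- (b) early relaxation, via the grid injection identity and the period energy balance
    obtain ⟨hcl, hτ, hper⟩ := hsol j
    have hI := (impulseGrid_gridInjectionIdentity Λ (ν j) c Φ Ψ G (u j 0) (u j) (hν j) hΦ hΨ hG hΨinv
      hGinv hG0 hGdiv hΨ' (hLH j) (hsup j)).1
    rw [hnorm] at hI
    -- the three long-time averages are period means
    have hA : Λ.longTimeAvg (fun t => ∫ x, ⟪G x, u j t x⟫) = (τ j)⁻¹ * ∫ t in (0 : ℝ)..τ j, ∫ x, ⟪G x, u j t x⟫ :=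
      longTimeAvg_eq_periodMean Λ hper hτ fun v => ∫ x, ⟪G x, v x⟫
    have hF : Λ.longTimeAvg (fun t => ∫ x, ⟪Φ x • G x, u j t x⟫) =
        (τ j)⁻¹ * (ν j * ∫ t in (0 : ℝ)..τ j, gradNormSq (u j t)) := by
      rw [longTimeAvg_eq_periodMean Λ hper hτ fun v => ∫ x, ⟪Φ x • G x, v x⟫,
        period_work_eq_dissipation hcl hper hτ]
    have hL : Λ.longTimeAvg (fun t => ∫ x, ⟪u j t x, Torus.laplacian (fun y => Ψ y • G y) x⟫) =
        (τ j)⁻¹ * ∫ t in (0 : ℝ)..τ j, ∫ x, ⟪u j t x, Torus.laplacian (fun y => Ψ y • G y) x⟫ :=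
      longTimeAvg_eq_periodMean Λ hper hτ fun v => ∫ x, ⟪v x, Torus.laplacian (fun y => Ψ y • G y) x⟫
    -- split the hypothesis (b) into its two interval integrals
    have iD : IntervalIntegrable (fun t => ν j * gradNormSq (u j t)) volume 0 (τ j) :=
      ((continuous_gradNormSq hcl).continuousOn.intervalIntegrable).const_mul (ν j)
    have iA : IntervalIntegrable (fun t => ∫ x, ⟪G x, u j t x⟫) volume 0 (τ j) :=
      (continuous_integral_inner_const hcl hG).continuousOn.intervalIntegrable
    have hbj := hb j
    rw [intervalIntegral.integral_sub iD iA, intervalIntegral.integral_const_mul] at hbj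
    -- assemble
    set A := ∫ t in (0 : ℝ)..τ j, ∫ x, ⟪G x, u j t x⟫ with hAdef
    set D := ∫ t in (0 : ℝ)..τ j, gradNormSq (u j t) with hDdef
    set L := ∫ t in (0 : ℝ)..τ j, ∫ x, ⟪u j t x, Torus.laplacian (fun y => Ψ y • G y) x⟫ with hLdef
    have hτinv : 0 < (τ j)⁻¹ := inv_pos.2 hτ
    have key : Λ.longTimeAvg (fun t => ∫ x, ⟪u j t x - c • EuclideanSpace.single 0 1,
        Torus.convect (fun y => u j t y - c • EuclideanSpace.single 0 1) (fun y => Ψ y • G y) x⟫) =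
        -((τ j)⁻¹ * (c * (ν j * D - A) + ν j * L)) := by
      rw [hA, hF, hL] at hI
      linear_combination hI
    rw [key, neg_le_neg_iff]
    calc η = (τ j)⁻¹ * (τ j * η) := by field_simp
      _ ≤ (τ j)⁻¹ * (c * (ν j * D - A) + ν j * L) := mul_le_mul_of_nonneg_left hbj hτinv.le

end Transfer

end Summit.AnomalousDissipation.AnomalousDissipation.Theorems.ImpulseGridGridSigns

end
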